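import Summits.Ventures.CertifiedManyBodySolver.Observables.StiffnessApexTransportCurtain
import HarnessLib

/-!
# Ventures/CertifiedManyBodySolver — Observables/StiffnessApexTransportCurtainLaBoxE.lean

HONEST FRAMING: one-sided certified CEILINGS on the uniform flux stiffness (`t–t′` f-sum class) at half filling, transported into a `(t′, U)`
box from a «curtain» of sources; a ceiling never speaks to the presence of order; not a `T_c` estimate, not a superconductivity verdict; every
leaf is CONDITIONAL on the row families it names. Zero compute, no definition, no claim node, no `sorry`.

Cell `pub/hubbard-downfold` (D-0150 L-DF2 «box ↦ one word»), seat `hubbard-downfold-unc-2` (`prover-hubbard-downfold-unc-2-g15-0`); companion of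
`Observables/StiffnessApexTransportCurtain.lean` (slot engine, master curtain theorem, editions (E1) one station with a CORNER-OBJECTIVE overhang /
(E2) the «L» bottom inner segment + left edge / (E3) partial left edge + short corner-objective overhang). Here:

* §4 CHORD forms — what two-corner shared-dual bundles deliver (`val` = the chord of two corner constants): (E1) inner chord on `[p, q] × {U_A}` +
  overhang chord on `[p(2 − U_A/U_max), p] × {U_A}` for the FIXED objective `−X₀(p)` (`…_innerChord_and_cornerObjectiveOverhangChord`); (E2) bottom
  chord + left-edge chord IN `U` on `{p} × [U_A, U_max]` (`…_bottomChord_and_leftEdgeChord`) — box word `c ≥ max` of the four corner constants;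
* §5 «La214-E» `[−3/10, −1/5] × [29/5, 74/5]` at `n = 1`: (E1) station `29/5`, inner bundle `[−3/10, −1/5]` + overhang bundle `[−357/740, −3/10]`
  with objective `−X₀(−3/10)`; (E2) bottom bundle + left edge `{−3/10} × [29/5, 74/5]`; (E3) `U_L = 11`: left edge `[29/5, 11]` + overhang
  `[−279/740, −3/10] × {11}` with objective `−X₀(−3/10)`.

Planning arithmetic [float] (not of record): under (E1) every overhang source is asked for `−¼e_{Φ(1,−3/5,0)}`, kinematic scale `k(−3/10) = 0.4392`
(the bar 0.4364687 is 0.6 % below it), instead of its own word (`k(−357/740) = 0.5037`, 13.3 %); under (E2) no source lies outside the box.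

References: T. Koma, H. Tasaki, J. Stat. Phys. 76 (1994) 745, §1 [KomaTasaki1994]; D. J. Scalapino, S. R. White, S.-C. Zhang, PRB 47 (1993)
7995, §II [ScalapinoWhiteZhang1993].
-/

noncomputable section

namespace Summit.Ventures.CertifiedManyBodySolver.Observables

open Literature.MathematicalPhysics.QuantumLattice
open Literature.MathematicalPhysics.QuantumLattice.ThermodynamicLimit
open Literature.MathematicalPhysics.QuantumFieldTheory
open Literature.Probability.LatticeModels
open Matrix Finset Filter Topology HubbardWave0
open scoped Matrix BigOperators ComplexOrder

/-! ## §4 CHORD forms: what two-corner shared-dual bundles deliver -/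

section Chords

variable {UA Umax p q : ℝ}

/-- **(E1) from TWO bundles at one station, four corner constants.** `p(2 − U_A/U_max) < p < q ≤ 0 < U_A ≤ U_max`. The INNER bundle: the
chord of the own-word corner constants `vI₁` (at `p`) and `vI₂` (at `q`) on `[p, q] × {U_A}`; the OVERHANG bundle: the chord of the corner constants
`vO₁` (at `p(2 − U_A/U_max)`) and `vO₂` (at `p`) for the FIXED objective `−X₀(p)` on `[p(2 − U_A/U_max), p] × {U_A}`. Then
`ObsStiffnessSeqCeilingAt t′ U 1 c` on the whole box for every `c ≥ max(−vI₁, −vI₂, −vO₁, −vO₂)`. (The corner `(p, U_A)` carries the same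
objective `−X₀(p)` in both bundles: one certificate serves `vI₁` and `vO₂`.) [cite: KomaTasaki1994, §1] [cite: ScalapinoWhiteZhang1993, §II] -/
theorem ObsStiffnessSeqCeilingAt_halfFilling_on_box_of_apexStation_innerChord_and_cornerObjectiveOverhangChord (hUA : 0 < UA)
    (hUmax : UA ≤ Umax) (hq : q ≤ 0) (hpq : p < q) (hov : p * (2 - UA / Umax) < p) (vI₁ vI₂ vO₁ vO₂ : ℝ) (c : ℚ)
    (hcI₁ : -vI₁ ≤ ((c : ℚ) : ℝ)) (hcI₂ : -vI₂ ≤ ((c : ℚ) : ℝ)) (hcO₁ : -vO₁ ≤ ((c : ℚ) : ℝ)) (hcO₂ : -vO₂ ≤ ((c : ℚ) : ℝ))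
    (hI : ∀ s ∈ Set.Icc p q,
      ∀ (ω : InfVolFermionState 2) (Ls : ℕ → ℕ) (ψ : ∀ L, Fock (Orb (FermionTorus 2 L))),
      Tendsto Ls atTop atTop →
      (∀ j, IsGroundStateInSector (hubbardTorusTT' (Ls j) 1 s UA) (rectN 1 (Ls j)) 0 (ψ (Ls j))) →
      (∀ j, star (ψ (Ls j)) ⬝ᵥ ψ (Ls j) = 1) → ω.IsTorusLimitOf ψ Ls →
      (q - s) / (q - p) * vI₁ + (s - p) / (q - p) * vI₂ ≤
        ((Finset.univ : Finset (DihedralGroup 4)).card : ℝ)⁻¹ * ∑ g ∈ (Finset.univ : Finset (DihedralGroup 4)),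
          (ω.expect (d4ShiftSet g 0 (box 2 7)) (fermionEmbed (PolySite.d4Emb g 0 (box 2 7)) (-oddMomentObsTT s UA 0))).re)
    (hO : ∀ s ∈ Set.Icc (p * (2 - UA / Umax)) p,
      ∀ (ω : InfVolFermionState 2) (Ls : ℕ → ℕ) (ψ : ∀ L, Fock (Orb (FermionTorus 2 L))),
      Tendsto Ls atTop atTop →
      (∀ j, IsGroundStateInSector (hubbardTorusTT' (Ls j) 1 s UA) (rectN 1 (Ls j)) 0 (ψ (Ls j))) →
      (∀ j, star (ψ (Ls j)) ⬝ᵥ ψ (Ls j) = 1) → ω.IsTorusLimitOf ψ Ls →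
      (p - s) / (p - p * (2 - UA / Umax)) * vO₁ + (s - p * (2 - UA / Umax)) / (p - p * (2 - UA / Umax)) * vO₂ ≤
        ((Finset.univ : Finset (DihedralGroup 4)).card : ℝ)⁻¹ * ∑ g ∈ (Finset.univ : Finset (DihedralGroup 4)),
          (ω.expect (d4ShiftSet g 0 (box 2 7)) (fermionEmbed (PolySite.d4Emb g 0 (box 2 7)) (-oddMomentObsTT p UA 0))).re) :
    ∀ tp ∈ Set.Icc p q, ∀ U ∈ Set.Icc UA Umax, ObsStiffnessSeqCeilingAt tp U 1 c := by
  refine ObsStiffnessSeqCeilingAt_halfFilling_on_box_of_apexStation_inner_and_cornerObjectiveOverhang hUA hUmax hpq.le hq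
    (fun s => (q - s) / (q - p) * vI₁ + (s - p) / (q - p) * vI₂)
    (fun s => (p - s) / (p - p * (2 - UA / Umax)) * vO₁ + (s - p * (2 - UA / Umax)) / (p - p * (2 - UA / Umax)) * vO₂) c hI
    (fun s hs => ?_) hO (fun s hs => ?_)
  · obtain ⟨hl₁, hl₂, hsum, -, -⟩ := tPrimeSegment_weights hpq hs.1 hs.2
    have hmin := min_le_chord_of_weights (c₁ := vI₁) (c₂ := vI₂) hl₁ hl₂ hsum
    have hneg : -min vI₁ vI₂ ≤ ((c : ℚ) : ℝ) := by
      rcases le_total vI₁ vI₂ with hv | hv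
      · rw [min_eq_left hv]; exact hcI₁
      · rw [min_eq_right hv]; exact hcI₂
    linarith
  · obtain ⟨hl₁, hl₂, hsum, -, -⟩ := tPrimeSegment_weights hov hs.1 hs.2
    have hmin := min_le_chord_of_weights (c₁ := vO₁) (c₂ := vO₂) hl₁ hl₂ hsum
    have hneg : -min vO₁ vO₂ ≤ ((c : ℚ) : ℝ) := by
      rcases le_total vO₁ vO₂ with hv | hv
      · rw [min_eq_left hv]; exact hcO₁
      · rw [min_eq_right hv]; exact hcO₂
    linarith

/-- **(E2) from a bottom bundle and a left-edge bundle, four corner constants (three corners).** `p < q ≤ 0 < U_A < U_max`. BOTTOM: the chord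
of the own-word corner constants `vB₁` (at `(p, U_A)`) and `vB₂` (at `(q, U_A)`); LEFT: the chord IN `U` of the own-word corner constants `vL₁`
(at `(p, U_A)`) and `vL₂` (at `(p, U_max)`) — what two certificates at the ends of the left edge sharing one dual give, the `λ = 0` word being
`U`-free and the commutator constraints affine in `U`. Then `ObsStiffnessSeqCeilingAt t′ U 1 c` on the whole box for every
`c ≥ max(−vB₁, −vB₂, −vL₁, −vL₂)`: THREE corner certificates (`(p,U_A)` twice, `(q,U_A)`, `(p,U_max)`) in two bundles word the box with no source
outside it. [cite: KomaTasaki1994, §1] [cite: ScalapinoWhiteZhang1993, §II] -/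
theorem ObsStiffnessSeqCeilingAt_halfFilling_on_box_of_bottomChord_and_leftEdgeChord (hUA : 0 < UA) (hUmax : UA < Umax)
    (hq : q ≤ 0) (hpq : p < q) (vB₁ vB₂ vL₁ vL₂ : ℝ) (c : ℚ)
    (hcB₁ : -vB₁ ≤ ((c : ℚ) : ℝ)) (hcB₂ : -vB₂ ≤ ((c : ℚ) : ℝ)) (hcL₁ : -vL₁ ≤ ((c : ℚ) : ℝ)) (hcL₂ : -vL₂ ≤ ((c : ℚ) : ℝ))
    (hB : ∀ s ∈ Set.Icc p q,
      ∀ (ω : InfVolFermionState 2) (Ls : ℕ → ℕ) (ψ : ∀ L, Fock (Orb (FermionTorus 2 L))),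
      Tendsto Ls atTop atTop →
      (∀ j, IsGroundStateInSector (hubbardTorusTT' (Ls j) 1 s UA) (rectN 1 (Ls j)) 0 (ψ (Ls j))) →
      (∀ j, star (ψ (Ls j)) ⬝ᵥ ψ (Ls j) = 1) → ω.IsTorusLimitOf ψ Ls →
      (q - s) / (q - p) * vB₁ + (s - p) / (q - p) * vB₂ ≤
        ((Finset.univ : Finset (DihedralGroup 4)).card : ℝ)⁻¹ * ∑ g ∈ (Finset.univ : Finset (DihedralGroup 4)),
          (ω.expect (d4ShiftSet g 0 (box 2 7)) (fermionEmbed (PolySite.d4Emb g 0 (box 2 7)) (-oddMomentObsTT s UA 0))).re)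
    (hL : ∀ U' ∈ Set.Icc UA Umax,
      ∀ (ω : InfVolFermionState 2) (Ls : ℕ → ℕ) (ψ : ∀ L, Fock (Orb (FermionTorus 2 L))),
      Tendsto Ls atTop atTop →
      (∀ j, IsGroundStateInSector (hubbardTorusTT' (Ls j) 1 p U') (rectN 1 (Ls j)) 0 (ψ (Ls j))) →
      (∀ j, star (ψ (Ls j)) ⬝ᵥ ψ (Ls j) = 1) → ω.IsTorusLimitOf ψ Ls →
      (Umax - U') / (Umax - UA) * vL₁ + (U' - UA) / (Umax - UA) * vL₂ ≤
        ((Finset.univ : Finset (DihedralGroup 4)).card : ℝ)⁻¹ * ∑ g ∈ (Finset.univ : Finset (DihedralGroup 4)),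
          (ω.expect (d4ShiftSet g 0 (box 2 7)) (fermionEmbed (PolySite.d4Emb g 0 (box 2 7)) (-oddMomentObsTT p U' 0))).re) :
    ∀ tp ∈ Set.Icc p q, ∀ U ∈ Set.Icc UA Umax, ObsStiffnessSeqCeilingAt tp U 1 c := by
  refine ObsStiffnessSeqCeilingAt_halfFilling_on_box_of_bottomEdge_and_leftEdge hUA hUmax.le hq
    (fun s => (q - s) / (q - p) * vB₁ + (s - p) / (q - p) * vB₂)
    (fun U' => (Umax - U') / (Umax - UA) * vL₁ + (U' - UA) / (Umax - UA) * vL₂) c hB (fun s hs => ?_) hL (fun U' hU' => ?_)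
  · obtain ⟨hl₁, hl₂, hsum, -, -⟩ := tPrimeSegment_weights hpq hs.1 hs.2
    have hmin := min_le_chord_of_weights (c₁ := vB₁) (c₂ := vB₂) hl₁ hl₂ hsum
    have hneg : -min vB₁ vB₂ ≤ ((c : ℚ) : ℝ) := by
      rcases le_total vB₁ vB₂ with hv | hv
      · rw [min_eq_left hv]; exact hcB₁
      · rw [min_eq_right hv]; exact hcB₂
    linarith
  · obtain ⟨hl₁, hl₂, hsum, -, -⟩ := tPrimeSegment_weights hUmax hU'.1 hU'.2
    have hmin := min_le_chord_of_weights (c₁ := vL₁) (c₂ := vL₂) hl₁ hl₂ hsum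
    have hneg : -min vL₁ vL₂ ≤ ((c : ℚ) : ℝ) := by
      rcases le_total vL₁ vL₂ with hv | hv
      · rw [min_eq_left hv]; exact hcL₁
      · rw [min_eq_right hv]; exact hcL₂
    linarith

end Chords

/-! ## §5 «La214-E» `[−3/10, −1/5] × [29/5, 74/5]` at `n = 1`: the three curtain editions -/

section LaBoxE

/-- **«La214-E» (E1): one station `29/5`, inner bundle `[−3/10, −1/5]` (own words) + overhang bundle `[−357/740, −3/10]` with the FIXED
corner objective `−X₀(−3/10)`**, both with `−val ≤ c` ⇒ `ObsStiffnessSeqCeilingAt t′ U 1 c` on the whole box. The overhang sources are asked for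
`−¼e_{Φ(1,−3/5,0)}` — kinematic scale `k(−3/10)` at every one of them — not for their own words. [cite: KomaTasaki1994, §1] [cite: ScalapinoWhiteZhang1993, §II] -/
theorem ObsStiffnessSeqCeilingAt_on_laBoxE_of_apexStation29o5_inner_and_cornerObjectiveOverhang (valI valO : ℝ → ℝ) (c : ℚ)
    (hI : ∀ s ∈ Set.Icc (-3 / 10 : ℝ) (-1 / 5),
      ∀ (ω : InfVolFermionState 2) (Ls : ℕ → ℕ) (ψ : ∀ L, Fock (Orb (FermionTorus 2 L))),
      Tendsto Ls atTop atTop →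
      (∀ j, IsGroundStateInSector (hubbardTorusTT' (Ls j) 1 s (29 / 5)) (rectN 1 (Ls j)) 0 (ψ (Ls j))) →
      (∀ j, star (ψ (Ls j)) ⬝ᵥ ψ (Ls j) = 1) → ω.IsTorusLimitOf ψ Ls →
      valI s ≤ ((Finset.univ : Finset (DihedralGroup 4)).card : ℝ)⁻¹ * ∑ g ∈ (Finset.univ : Finset (DihedralGroup 4)),
        (ω.expect (d4ShiftSet g 0 (box 2 7)) (fermionEmbed (PolySite.d4Emb g 0 (box 2 7)) (-oddMomentObsTT s (29 / 5) 0))).re)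
    (hcI : ∀ s ∈ Set.Icc (-3 / 10 : ℝ) (-1 / 5), -valI s ≤ ((c : ℚ) : ℝ))
    (hO : ∀ s ∈ Set.Icc (-(357 / 740) : ℝ) (-3 / 10),
      ∀ (ω : InfVolFermionState 2) (Ls : ℕ → ℕ) (ψ : ∀ L, Fock (Orb (FermionTorus 2 L))),
      Tendsto Ls atTop atTop →
      (∀ j, IsGroundStateInSector (hubbardTorusTT' (Ls j) 1 s (29 / 5)) (rectN 1 (Ls j)) 0 (ψ (Ls j))) →
      (∀ j, star (ψ (Ls j)) ⬝ᵥ ψ (Ls j) = 1) → ω.IsTorusLimitOf ψ Ls →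
      valO s ≤ ((Finset.univ : Finset (DihedralGroup 4)).card : ℝ)⁻¹ * ∑ g ∈ (Finset.univ : Finset (DihedralGroup 4)),
        (ω.expect (d4ShiftSet g 0 (box 2 7)) (fermionEmbed (PolySite.d4Emb g 0 (box 2 7)) (-oddMomentObsTT (-3 / 10) (29 / 5) 0))).re)
    (hcO : ∀ s ∈ Set.Icc (-(357 / 740) : ℝ) (-3 / 10), -valO s ≤ ((c : ℚ) : ℝ)) :
    ∀ tp ∈ Set.Icc (-3 / 10 : ℝ) (-1 / 5), ∀ U ∈ Set.Icc (29 / 5 : ℝ) (74 / 5), ObsStiffnessSeqCeilingAt tp U 1 c := by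
  have e : (-3 / 10 : ℝ) * (2 - 29 / 5 / (74 / 5)) = -(357 / 740) := by norm_num
  refine ObsStiffnessSeqCeilingAt_halfFilling_on_box_of_apexStation_inner_and_cornerObjectiveOverhang (by norm_num) (by norm_num)
    (by norm_num) (by norm_num) valI valO c hI hcI (fun s hs => ?_) (fun s hs => ?_)
  · rw [e] at hs; exact hO s hs
  · rw [e] at hs; exact hcO s hs

/-- **«La214-E» (E2), the «L»: bottom inner bundle `[−3/10, −1/5] × {29/5}` + LEFT EDGE `{−3/10} × [29/5, 74/5]`** (own words, `−val ≤ c`) ⇒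
`ObsStiffnessSeqCeilingAt t′ U 1 c` on the whole box; no source outside the box. [cite: KomaTasaki1994, §1] [cite: ScalapinoWhiteZhang1993, §II] -/
theorem ObsStiffnessSeqCeilingAt_on_laBoxE_of_bottomEdge_and_leftEdge (valB valL : ℝ → ℝ) (c : ℚ)
    (hB : ∀ s ∈ Set.Icc (-3 / 10 : ℝ) (-1 / 5),
      ∀ (ω : InfVolFermionState 2) (Ls : ℕ → ℕ) (ψ : ∀ L, Fock (Orb (FermionTorus 2 L))),
      Tendsto Ls atTop atTop →
      (∀ j, IsGroundStateInSector (hubbardTorusTT' (Ls j) 1 s (29 / 5)) (rectN 1 (Ls j)) 0 (ψ (Ls j))) →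
      (∀ j, star (ψ (Ls j)) ⬝ᵥ ψ (Ls j) = 1) → ω.IsTorusLimitOf ψ Ls →
      valB s ≤ ((Finset.univ : Finset (DihedralGroup 4)).card : ℝ)⁻¹ * ∑ g ∈ (Finset.univ : Finset (DihedralGroup 4)),
        (ω.expect (d4ShiftSet g 0 (box 2 7)) (fermionEmbed (PolySite.d4Emb g 0 (box 2 7)) (-oddMomentObsTT s (29 / 5) 0))).re)
    (hcB : ∀ s ∈ Set.Icc (-3 / 10 : ℝ) (-1 / 5), -valB s ≤ ((c : ℚ) : ℝ))
    (hL : ∀ U' ∈ Set.Icc (29 / 5 : ℝ) (74 / 5),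
      ∀ (ω : InfVolFermionState 2) (Ls : ℕ → ℕ) (ψ : ∀ L, Fock (Orb (FermionTorus 2 L))),
      Tendsto Ls atTop atTop →
      (∀ j, IsGroundStateInSector (hubbardTorusTT' (Ls j) 1 (-3 / 10) U') (rectN 1 (Ls j)) 0 (ψ (Ls j))) →
      (∀ j, star (ψ (Ls j)) ⬝ᵥ ψ (Ls j) = 1) → ω.IsTorusLimitOf ψ Ls →
      valL U' ≤ ((Finset.univ : Finset (DihedralGroup 4)).card : ℝ)⁻¹ * ∑ g ∈ (Finset.univ : Finset (DihedralGroup 4)),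
        (ω.expect (d4ShiftSet g 0 (box 2 7)) (fermionEmbed (PolySite.d4Emb g 0 (box 2 7)) (-oddMomentObsTT (-3 / 10) U' 0))).re)
    (hcL : ∀ U' ∈ Set.Icc (29 / 5 : ℝ) (74 / 5), -valL U' ≤ ((c : ℚ) : ℝ)) :
    ∀ tp ∈ Set.Icc (-3 / 10 : ℝ) (-1 / 5), ∀ U ∈ Set.Icc (29 / 5 : ℝ) (74 / 5), ObsStiffnessSeqCeilingAt tp U 1 c :=
  ObsStiffnessSeqCeilingAt_halfFilling_on_box_of_bottomEdge_and_leftEdge (by norm_num) (by norm_num) (by norm_num) valB valL c hB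
    hcB hL hcL

/-- The (E3) overhang at station `11` of «La214-E»: `(−3/10)·(2 − 11/(74/5)) = −279/740` (`≈ −0.377`). [folklore] -/
theorem laBoxE_curtain11_overhang : (-3 / 10 : ℝ) * (2 - 11 / (74 / 5)) = -(279 / 740) := by norm_num

/-- **«La214-E» (E3) with `U_L = 11`: bottom inner bundle `[−3/10, −1/5] × {29/5}` (own words) + left edge `{−3/10} × [29/5, 11]` (own words)
+ overhang bundle `[−279/740, −3/10] × {11}` with the FIXED corner objective `−X₀(−3/10)`**, all with `−val ≤ c` ⇒ `ObsStiffnessSeqCeilingAt t′ U 1 c`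
on the whole box `[−3/10, −1/5] × [29/5, 74/5]`. [cite: KomaTasaki1994, §1] [cite: ScalapinoWhiteZhang1993, §II] -/
theorem ObsStiffnessSeqCeilingAt_on_laBoxE_of_curtain11 (valB valL valO : ℝ → ℝ) (c : ℚ)
    (hB : ∀ s ∈ Set.Icc (-3 / 10 : ℝ) (-1 / 5),
      ∀ (ω : InfVolFermionState 2) (Ls : ℕ → ℕ) (ψ : ∀ L, Fock (Orb (FermionTorus 2 L))),
      Tendsto Ls atTop atTop →
      (∀ j, IsGroundStateInSector (hubbardTorusTT' (Ls j) 1 s (29 / 5)) (rectN 1 (Ls j)) 0 (ψ (Ls j))) →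
      (∀ j, star (ψ (Ls j)) ⬝ᵥ ψ (Ls j) = 1) → ω.IsTorusLimitOf ψ Ls →
      valB s ≤ ((Finset.univ : Finset (DihedralGroup 4)).card : ℝ)⁻¹ * ∑ g ∈ (Finset.univ : Finset (DihedralGroup 4)),
        (ω.expect (d4ShiftSet g 0 (box 2 7)) (fermionEmbed (PolySite.d4Emb g 0 (box 2 7)) (-oddMomentObsTT s (29 / 5) 0))).re)
    (hcB : ∀ s ∈ Set.Icc (-3 / 10 : ℝ) (-1 / 5), -valB s ≤ ((c : ℚ) : ℝ))
    (hL : ∀ U' ∈ Set.Icc (29 / 5 : ℝ) 11,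
      ∀ (ω : InfVolFermionState 2) (Ls : ℕ → ℕ) (ψ : ∀ L, Fock (Orb (FermionTorus 2 L))),
      Tendsto Ls atTop atTop →
      (∀ j, IsGroundStateInSector (hubbardTorusTT' (Ls j) 1 (-3 / 10) U') (rectN 1 (Ls j)) 0 (ψ (Ls j))) →
      (∀ j, star (ψ (Ls j)) ⬝ᵥ ψ (Ls j) = 1) → ω.IsTorusLimitOf ψ Ls →
      valL U' ≤ ((Finset.univ : Finset (DihedralGroup 4)).card : ℝ)⁻¹ * ∑ g ∈ (Finset.univ : Finset (DihedralGroup 4)),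
        (ω.expect (d4ShiftSet g 0 (box 2 7)) (fermionEmbed (PolySite.d4Emb g 0 (box 2 7)) (-oddMomentObsTT (-3 / 10) U' 0))).re)
    (hcL : ∀ U' ∈ Set.Icc (29 / 5 : ℝ) 11, -valL U' ≤ ((c : ℚ) : ℝ))
    (hO : ∀ s ∈ Set.Icc (-(279 / 740) : ℝ) (-3 / 10),
      ∀ (ω : InfVolFermionState 2) (Ls : ℕ → ℕ) (ψ : ∀ L, Fock (Orb (FermionTorus 2 L))),
      Tendsto Ls atTop atTop →
      (∀ j, IsGroundStateInSector (hubbardTorusTT' (Ls j) 1 s 11) (rectN 1 (Ls j)) 0 (ψ (Ls j))) →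
      (∀ j, star (ψ (Ls j)) ⬝ᵥ ψ (Ls j) = 1) → ω.IsTorusLimitOf ψ Ls →
      valO s ≤ ((Finset.univ : Finset (DihedralGroup 4)).card : ℝ)⁻¹ * ∑ g ∈ (Finset.univ : Finset (DihedralGroup 4)),
        (ω.expect (d4ShiftSet g 0 (box 2 7)) (fermionEmbed (PolySite.d4Emb g 0 (box 2 7)) (-oddMomentObsTT (-3 / 10) 11 0))).re)
    (hcO : ∀ s ∈ Set.Icc (-(279 / 740) : ℝ) (-3 / 10), -valO s ≤ ((c : ℚ) : ℝ)) :
    ∀ tp ∈ Set.Icc (-3 / 10 : ℝ) (-1 / 5), ∀ U ∈ Set.Icc (29 / 5 : ℝ) (74 / 5), ObsStiffnessSeqCeilingAt tp U 1 c := by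
  refine ObsStiffnessSeqCeilingAt_halfFilling_on_box_of_curtain_orbitLower (UL := 11) (Umax := 74 / 5) (by norm_num) (by norm_num)
    (by norm_num) valB valL valO c hB hcB hL hcL (fun s hs => ?_) (fun s hs => ?_)
  · rw [laBoxE_curtain11_overhang] at hs; exact hO s hs
  · rw [laBoxE_curtain11_overhang] at hs; exact hcO s hs

end LaBoxE

end Summit.Ventures.CertifiedManyBodySolver.Observables

end
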